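import Summits.PneNP.PneNP.Theses.PositionalGames
import Summits.PneNP.PneNP.Theorems.PositionalGamesParityToMpg
import Summits.PneNP.PneNP.Theorems.PositionalGamesMpgTargetOfCruxes
import HarnessLib

/-!
# Crux `MpgGeneralSuperpoly` (stmt-PneNP-1292) — birth skeletons of the two pieces of the registered decomposition
# (crux-strategist, BC2 redirect; a DEPENDENCY skeleton, not a line of attack)

X = `MpgGeneralSuperpoly` ⇐ M2 ∧ T-cap (glue `mpgTargetOfCruxes_proof`, landed, item stmt-PneNP-1302; frame-form copy
`Summit.PneNP.PneNP.Theorems.mpgGeneralSuperpoly_of_subs` in `Cruxes/MpgGeneralSuperpoly/Split.lean`).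

* Piece M2 = `MpgMonotoneSuperpoly` (stmt-PneNP-1295): its one typed sufficient condition today is the route's rank-2
  crux M1 = `ParityMonotoneSuperpoly` (stmt-PneNP-1294) through the landed glue `parityToMpg_proof` (Jurdziński's
  reduction as a monotone projection). A second honest stub for M2/M1 needs vocabulary the tree lacks (monotone
  Karchmer–Wigderson rectangle-dags for engine E1, approximator families for E2, a (min,+) → Boolean-monotone
  transfer for E3); the bare-existence typing of "universal trees grow inside monotone circuits" collapses to crux #5
  (see STRATEGY-CENSUS.md §D12), so it is not offered as a stub.
* Piece T-cap = `MpgNoMonotoneGap` (stmt-PneNP-1296): atomic model-comparison conjecture; no ≥ 2-stub skeleton short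
  of a monotonization theorem for game functions. Its decider pair: the one-player sub-case (cheapest falsifier) and
  the class-level repair `MpgNoMonotoneGapMax` (strategist `Repair.lean`, replacement glue proved).

Sorries live ONLY in the `stub_*` theorems (= open route items, by name); both compositions are kernel-checked.
-/

set_option linter.dupNamespace false

namespace Summit.PneNP.PneNP.Cruxes.MpgGeneralSuperpoly.Birth

open Summit.PneNP.PneNP.Theses.PositionalGames (ParityMonotoneSuperpoly MpgMonotoneSuperpoly MpgNoMonotoneGap
  MpgGeneralSuperpoly)

/-- Stub = route crux M1 `ParityMonotoneSuperpoly` (stmt-PneNP-1294, rank 2), by name. [conjecture — route crux #2] -/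
theorem stub_parityMonotoneSuperpoly : ParityMonotoneSuperpoly := by
  sorry

/-- Stub = route crux T-cap `MpgNoMonotoneGap` (stmt-PneNP-1296, rank 4), by name. [conjecture — route crux #4] -/
theorem stub_mpgNoMonotoneGap : MpgNoMonotoneGap := by
  sorry

/-- Birth skeleton of piece M2: `ParityMonotoneSuperpoly → MpgMonotoneSuperpoly` is the landed glue
`parityToMpg_proof` (stmt-PneNP-1301). [folklore] -/
theorem MpgMonotoneSuperpoly_of (hM1 : ParityMonotoneSuperpoly) : MpgMonotoneSuperpoly :=
  Summit.PneNP.PneNP.Theorems.parityToMpg_proof hM1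

/-- The registered decomposition, by name: `MpgMonotoneSuperpoly → MpgNoMonotoneGap → MpgGeneralSuperpoly` is the
landed glue `mpgTargetOfCruxes_proof` (stmt-PneNP-1302). [folklore] -/
theorem MpgGeneralSuperpoly_of (hM2 : MpgMonotoneSuperpoly) (hT : MpgNoMonotoneGap) : MpgGeneralSuperpoly :=
  Summit.PneNP.PneNP.Theorems.mpgTargetOfCruxes_proof hM2 hT

/-- The two-layer reading X ⇐ M1 ∧ T-cap (both layers' glue landed). [folklore] -/
theorem MpgGeneralSuperpoly_of_parity (hM1 : ParityMonotoneSuperpoly) (hT : MpgNoMonotoneGap) :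
    MpgGeneralSuperpoly :=
  MpgGeneralSuperpoly_of (MpgMonotoneSuperpoly_of hM1) hT

example : MpgGeneralSuperpoly := MpgGeneralSuperpoly_of_parity stub_parityMonotoneSuperpoly stub_mpgNoMonotoneGap

end Summit.PneNP.PneNP.Cruxes.MpgGeneralSuperpoly.Birth
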